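import Summits.HodgeConjecture.HodgeConjecture.Theorems.FirstOrderSemiregularSeedsFirstOrderWeilSeedsEightCPad4Anchor
import Literature.AlgebraicGeometry.HodgeTheory.ClassesSupportedOn
import Literature.AlgebraicGeometry.HodgeTheory.WeilTypePeriodPoint
import Literature.AlgebraicGeometry.HodgeTheory.WeilTypeAbelianVariety
import Literature.AlgebraicGeometry.HodgeTheory.WeilClassesBlochSeed
import Literature.AlgebraicGeometry.Motives.AbelianVarietyProjectiveChart
import HarnessLib

/-!
# Route `EightfoldBlochSeeds`, cruxes `BlochSeedsGeneric` (item stmt-HodgeConjecture-18880) / `BlochSeedDiscThree` (18882), line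
# `pad4-cm-anchor` (`Cruxes/BlochSeedsGeneric/Lines/pad4_cm_anchor.lean` fb115e60acaf2337, `Cruxes/BlochSeedDiscThree/Lines/pad4_cm_anchor.lean`
# d208bf462bd6e07f), stubs `stub_pad4_carrier` / `stub_rung_pad4_seedAt`: THE SUPPORTED-CLASS CLAUSE IS FREE AT THE ANCHOR —
# every `q·h_K⁴ + w` is supported on ONE Zariski-closed subset of codimension `≥ 4` of `S⁴(E₀)`, every `d`, every CM datum

HONEST FRAMING. Nothing here proves either stub, either crux, their sibling `BlochSeedDiscOne` (18881), rung H2, HC_AV or the Hodge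
conjecture; nothing is constructed (no subscheme, no bundle, no section). UNCONDITIONAL `--supports` lemmas only: no named fact is
taken as a hypothesis, no definition and no Literature fact is introduced (D-0026). Census-neutral.

WHAT IS HERE (leafhand `leafhand-hodge-eightfoldblochseed-1-g1`, refill order 2026-08-30T22:31:52Z (1), successor of g0). The carrier
sub-rung `stub_pad4_carrier` asks, for every discriminant `d ≥ 1` and every CM datum `(E₀, ψ₀)`, for `(e, a, w)` and an INTEGRAL closed
subscheme `i : Z ↪ S⁴(E₀)` which is a REGULAR IMMERSION OF CODIMENSION `4` with `q·h_K⁴ + w` SUPPORTED on its image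
(`classesSupportedOn`, the kernel of restriction to the complex points of the complement). This file settles what part of that
is free:

* §1 **single-support extraction** (`exists_isClosed_mem_classesSupportedOn_of_mem_supportedClasses`, `mem_supportedClasses_iff`,
  `mem_algebraicClasses_iff`): the tree's `Nʳ Hⁱ = supportedClasses X i r` is DEFINED as the `⨆` of the `classesSupportedOn X Z i`
  over Zariski-closed `Z` of codimension `≥ r`; a member of it is supported on ONE such `Z` (finite unions of closed
  codimension-`≥ r` subsets are again such, `classesSupportedOn_mono`, and `0` is supported on `∅`). General `X`; the converse is the
  tree's `classesSupportedOn_le_supportedClasses`. So `c ∈ algebraicClasses X k ↔ ∃ Z` closed of codimension `≥ k` with `c`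
  supported on `Z`.
* §2 **at the PAD-4 anchor, every `d`, every CM datum** (`pad4_hodgeClass_supportedOn_closed`,
  `pad4_ksymmPow_add_weil_supportedOn_closed`): every rational Hodge class of `S⁴(E₀)` is supported on one Zariski-closed subset
  of the right codimension (Tate–Murasaki at the anchor, the tree's `pad4Anchor_hodgeClass_mem_algebraicClasses`, through §1); in
  particular for EVERY projective embedding `e`, rational `a ≠ 0`, `q ∈ ℚ` and rational `w` of the Weil plane of `(S⁴, Ψ)`,
  `Ψ = (ψ₀ × (−ψ₀))⁴`, the class `q·h_K⁴ + w` (`h_K = d·e^*a + Ψ^*e^*a`, rational of type `(1,1)` by the tree's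
  `isRationalClass_ksymm` / `isOfHodgeType_one_one_ksymm`; `w` of type `(4,4)` because `(S⁴, Ψ)` is of Weil type, being hyperbolic)
  is supported on a Zariski-closed `Y ⊂ S⁴` all of whose points have codimension `≥ 4`.
* §3 **the carrier stub with «integral scheme, regular immersion of codimension 4» replaced by «Zariski-closed subset of codimension
  ≥ 4» HOLDS** (`exists_pad4_carrierShape_closedSupport`): `∃ e a w`, `a` rational `≠ 0`, `(S⁴, Ψ)` hyperbolic for `h_K`, `w ≠ 0`
  rational in the Weil plane, and for every `q` a closed codimension-`≥ 4` support of `q·h_K⁴ + w` — every `d ≥ 1`. Read with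
  Fulton's purity `H⁸_Z(S⁴) = ℂ·cl(Z)` for `Z` irreducible of codimension `4` (NOT in the tree, and not used here), this locates the
  ENTIRE content of the sub-rung in the two deleted words: an irreducible local complete intersection `Z` of codimension exactly
  `4` supports only the line `ℂ·cl(Z)`, so it carries `q·h_K⁴ + w` iff `cl(Z) ∈ ℚ·h_K⁴ ⊕ W_K` with non-zero Weil part — and then
  `q ≠ 0` (`cl(Z) ⌣ h_K⁴ = deg_{h_K} Z > 0` while `w ⌣ h_K⁴ = 0`, the tree's `cupProduct_eq_zero_of_map_eq_smul_of_mem_weilClassesOf`),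
  whereas the closed supports produced here are, for `q = 0`, necessarily REDUCIBLE unions of subvarieties. The census of the
  `d = 1` hand and of g0 is thereby sharpened, uniformly in `d`: «supported class» costs nothing; «one integral lci fourfold whose
  class lies in `ℚ·h_K⁴ ⊕ W_K` off `ℚ·h_K⁴`» is everything ((L-Port) Thom–Porteous, (L-BK-deg) Kleiman–Bertini for degeneracy loci,
  (L-FL-deg) Fulton–Lazarsfeld, and a locally free module with Weil-bearing `c₄` — none in the tree).
* §4 **the rung's semiregularity clause, unfolded once** (`isBlochSemiregular_eight_four_iff`): for any `i : Z ⟶ X` over `ℂ`,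
  `IsBlochSemiregular i (2·4) 4 ↔` surjectivity of Bloch's pairing map `H³(X, Ω⁵_X) → H³(X, 𝓐lt₃(𝓘; Ω⁸_X|_Z))` (Buchweitz–Flenner
  (8.1) (2) at `r = 3`, `m = 4`, `k = 3`) — the literal proof obligation of `stub_rung_pad4_seedAt` beyond the carrier, on Mathlib's
  sheaf cohomology of real module sheaves (the crux workfile `Cruxes/BlochSeedDiscOne/SeedCheckerPorteous.lean` has the `d = 1`
  anchor instance; this is the importable general form).

## References

[cite: GrothendieckTopology1969, §1] [cite: Fulton1998, §19.1 eq. (1) and Lemma 19.1.1] [cite: vanGeemen1994HodgeAV, Thm. 4.3, 4.10, Lemma 5.2]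
[cite: Gordon1997, §3] [cite: BuchweitzFlenner2003, (8.1) (2)] [cite: Bloch1972Semiregularity, Remark (7.5)]
-/

noncomputable section

-- single-problem summit (Problem = Summit): the mandated namespace repeats `HodgeConjecture`.
set_option linter.dupNamespace false

open CategoryTheory AlgebraicGeometry
open Literature.AlgebraicGeometry Literature.AlgebraicGeometry.Motives Literature.AlgebraicGeometry.HodgeTheory
open Literature.AlgebraicTopology.SingularHomology

namespace Summit.HodgeConjecture.HodgeConjecture.Theorems

/-! ## §1 Single-support extraction from `supportedClasses` / `algebraicClasses` (general `X`) -/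

section SingleSupport

variable {X : Motives.SchemeOver ℂ} {i r : ℕ}

/-- **A class supported in codimension `≥ r` is supported on ONE Zariski-closed subset of codimension `≥ r`.** The tree's
`supportedClasses X i r = Nʳ Hⁱ(X(ℂ); ℂ)` is the `⨆` over Zariski-closed `Z ⊆ X` all of whose points have codimension `≥ r` of
`ker (Hⁱ(X(ℂ)) → Hⁱ((X ∖ Z)(ℂ))) = classesSupportedOn X Z i`; the classes supported on SOME such `Z` form a submodule (`0` is
supported on `∅`; a sum is supported on the union, which is closed with the same pointwise codimension bound, by
`classesSupportedOn_mono`; scalars keep the support), which therefore contains the `⨆`. [cite: GrothendieckTopology1969, §1] -/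
theorem exists_isClosed_mem_classesSupportedOn_of_mem_supportedClasses {x : complexBetti X i}
    (hx : x ∈ supportedClasses X i r) :
    ∃ Z : Set X.left, IsClosed Z ∧ (∀ z ∈ Z, (r : ℕ∞) ≤ Order.coheight z) ∧ x ∈ classesSupportedOn X Z i := by
  let S : Submodule ℂ (complexBetti X i) :=
    { carrier := {y | ∃ Z : Set X.left, IsClosed Z ∧ (∀ z ∈ Z, (r : ℕ∞) ≤ Order.coheight z) ∧
        y ∈ classesSupportedOn X Z i}
      zero_mem' := ⟨∅, isClosed_empty, fun _ h => (Set.notMem_empty _ h).elim, Submodule.zero_mem _⟩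
      add_mem' := by
        rintro a b ⟨Z, hZ, hrZ, ha⟩ ⟨W, hW, hrW, hb⟩
        refine ⟨Z ∪ W, hZ.union hW, ?_, Submodule.add_mem _
          (classesSupportedOn_mono Set.subset_union_left i ha) (classesSupportedOn_mono Set.subset_union_right i hb)⟩
        rintro z (hz | hz)
        exacts [hrZ z hz, hrW z hz]
      smul_mem' := by
        rintro c a ⟨Z, hZ, hrZ, ha⟩
        exact ⟨Z, hZ, hrZ, Submodule.smul_mem _ c ha⟩ }
  have hle : supportedClasses X i r ≤ S := by
    unfold supportedClasses
    exact iSup_le fun Z => iSup_le fun hZ => iSup_le fun hr => fun y hy => ⟨Z, hZ, hr, hy⟩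
  exact hle hx

/-- **Membership in `Nʳ Hⁱ` unfolded to one support**: `x ∈ supportedClasses X i r ↔` `x` is supported on some Zariski-closed `Z` of
codimension `≥ r` (`⇐` is the tree's `classesSupportedOn_le_supportedClasses`). [cite: GrothendieckTopology1969, §1] -/
theorem mem_supportedClasses_iff {x : complexBetti X i} :
    x ∈ supportedClasses X i r ↔
      ∃ Z : Set X.left, IsClosed Z ∧ (∀ z ∈ Z, (r : ℕ∞) ≤ Order.coheight z) ∧ x ∈ classesSupportedOn X Z i :=
  ⟨exists_isClosed_mem_classesSupportedOn_of_mem_supportedClasses,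
    fun ⟨_, hZ, hr, hx⟩ => classesSupportedOn_le_supportedClasses hZ hr i hx⟩

/-- **Algebraic classes, one support at a time**: `c ∈ algebraicClasses X k` (`= Nᵏ H²ᵏ`, the span of the cycle classes of
codimension-`k` subvarieties for `X` smooth projective) iff `c` is supported on ONE Zariski-closed subset of codimension `≥ k`.
[cite: Fulton1998, §19.1 Lemma 19.1.1] [cite: GrothendieckTopology1969, §1] -/
theorem mem_algebraicClasses_iff {k : ℕ} {c : complexBetti X (2 * k)} :
    c ∈ algebraicClasses X k ↔
      ∃ Z : Set X.left, IsClosed Z ∧ (∀ z ∈ Z, (k : ℕ∞) ≤ Order.coheight z) ∧ c ∈ classesSupportedOn X Z (2 * k) :=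
  mem_supportedClasses_iff

end SingleSupport

/-! ## §2 At the PAD-4 anchor: every rational Hodge class, in particular every `q·h_K⁴ + w`, has ONE closed support -/

section Pad4

variable {d : ℕ} {E₀ : AbelianVariety ℂ} {ψ₀ : E₀ ⟶ E₀}

/-- **Every rational Hodge class of type `(p,p)` on the PAD-4 anchor `S⁴ = ((S × S) × S) × S`, `S = E₀ × E₀` (`dim E₀ = 1`), is
supported on ONE Zariski-closed subset all of whose points have codimension `≥ p`** — Tate–Murasaki at the anchor (the tree's
`pad4Anchor_hodgeClass_mem_algebraicClasses`: the Hodge ring of a power of an elliptic curve is generated by divisors) read through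
§1. [cite: vanGeemen1994HodgeAV, Thm. 4.3] [cite: Gordon1997, §3] [cite: Fulton1998, §19.1 Lemma 19.1.1] -/
theorem pad4_hodgeClass_supportedOn_closed (hE : E₀.dim = 1) {p : ℕ}
    {c : complexBetti ((((E₀.prod E₀).prod (E₀.prod E₀)).prod (E₀.prod E₀)).prod (E₀.prod E₀)).X (2 * p)}
    (hcQ : IsRationalClass c)
    (hc : IsOfHodgeType (2 * 4) ((((E₀.prod E₀).prod (E₀.prod E₀)).prod (E₀.prod E₀)).prod (E₀.prod E₀)).X (2 * p) p p c) :
    ∃ Y : Set ((((E₀.prod E₀).prod (E₀.prod E₀)).prod (E₀.prod E₀)).prod (E₀.prod E₀)).X.left,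
      IsClosed Y ∧ (∀ y ∈ Y, (p : ℕ∞) ≤ Order.coheight y) ∧
      c ∈ classesSupportedOn ((((E₀.prod E₀).prod (E₀.prod E₀)).prod (E₀.prod E₀)).prod (E₀.prod E₀)).X Y (2 * p) :=
  mem_algebraicClasses_iff.1 (pad4Anchor_hodgeClass_mem_algebraicClasses hE hcQ hc)

/-- **Every `q·h_K⁴ + w` is supported on ONE closed codimension-`≥ 4` subset of the anchor.** For every `d ≥ 1`, every CM datum
`(E₀, ψ₀)` (`dim E₀ = 1`, `ψ₀ ≫ ψ₀ = -d`), the nested action `Ψ = (ψ₀ × (−ψ₀))⁴` (the skeletons' `pad4Action E₀ ψ₀`; instantiate `hΨ` by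
`rfl`), EVERY projective embedding `e` with a rational `a ≠ 0`, every `q ∈ ℚ` and every rational class `w` of the Weil plane
`weilClassesOf S⁴ Ψ 4 d`: the class `q·h_K⁴ + w`, `h_K = d·e^*a + Ψ^*e^*a`, is supported on a Zariski-closed `Y ⊂ S⁴` all of whose points
have codimension `≥ 4`. (`h_K` is rational of type `(1,1)` — `isRationalClass_ksymm`, `isOfHodgeType_one_one_ksymm` — so `h_K⁴` is
rational of type `(4,4)` — `IsRationalClass.cupPowTwo`, `isOfHodgeType_cupPowTwo` on the smooth projective anchor; `(S⁴, Ψ)` is of Weil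
type, being hyperbolic for some polarisation by `pad4Anchor_hyperbolic_weilClass`, so `w` is of type `(4,4)` by van Geemen 4.10; then
`pad4_hodgeClass_supportedOn_closed`.) This is the supported-class clause of `stub_pad4_carrier` / `stub_rung_pad4_seedAt` for EVERY
`(e, a, q, w)`, with the support a closed SUBSET rather than an integral lci subscheme. [cite: vanGeemen1994HodgeAV, Thm. 4.3 and 4.10]
[cite: Fulton1998, §19.1 Lemma 19.1.1] -/
theorem pad4_ksymmPow_add_weil_supportedOn_closed (hd : 0 < d) (hE : E₀.dim = 1) (hψ : ψ₀ ≫ ψ₀ = -(d • 𝟙 E₀))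
    (Ψ : (((E₀.prod E₀).prod (E₀.prod E₀)).prod (E₀.prod E₀)).prod (E₀.prod E₀) ⟶
      (((E₀.prod E₀).prod (E₀.prod E₀)).prod (E₀.prod E₀)).prod (E₀.prod E₀))
    (hΨ : Ψ = AbelianVariety.prodLift
        (AbelianVariety.fst (((E₀.prod E₀).prod (E₀.prod E₀)).prod (E₀.prod E₀)) (E₀.prod E₀) ≫
          AbelianVariety.prodLift
            (AbelianVariety.fst ((E₀.prod E₀).prod (E₀.prod E₀)) (E₀.prod E₀) ≫
              AbelianVariety.prodLift
                (AbelianVariety.fst (E₀.prod E₀) (E₀.prod E₀) ≫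
                  AbelianVariety.prodLift (AbelianVariety.fst E₀ E₀ ≫ ψ₀) (AbelianVariety.snd E₀ E₀ ≫ (-ψ₀)))
                (AbelianVariety.snd (E₀.prod E₀) (E₀.prod E₀) ≫
                  AbelianVariety.prodLift (AbelianVariety.fst E₀ E₀ ≫ ψ₀) (AbelianVariety.snd E₀ E₀ ≫ (-ψ₀))))
            (AbelianVariety.snd ((E₀.prod E₀).prod (E₀.prod E₀)) (E₀.prod E₀) ≫
              AbelianVariety.prodLift (AbelianVariety.fst E₀ E₀ ≫ ψ₀) (AbelianVariety.snd E₀ E₀ ≫ (-ψ₀))))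
        (AbelianVariety.snd (((E₀.prod E₀).prod (E₀.prod E₀)).prod (E₀.prod E₀)) (E₀.prod E₀) ≫
          AbelianVariety.prodLift (AbelianVariety.fst E₀ E₀ ≫ ψ₀) (AbelianVariety.snd E₀ E₀ ≫ (-ψ₀))))
    (e : ProjectiveEmbedding ((((E₀.prod E₀).prod (E₀.prod E₀)).prod (E₀.prod E₀)).prod (E₀.prod E₀)).X)
    {a : complexBetti (projectiveSpace e.n ℂ) 2} (ha : IsRationalClass a) (ha0 : a ≠ 0) (q : ℚ)
    {w : complexBetti ((((E₀.prod E₀).prod (E₀.prod E₀)).prod (E₀.prod E₀)).prod (E₀.prod E₀)).X (2 * 4)}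
    (hwW : w ∈ weilClassesOf _ Ψ 4 d) (hwr : IsRationalClass w) :
    ∃ Y : Set ((((E₀.prod E₀).prod (E₀.prod E₀)).prod (E₀.prod E₀)).prod (E₀.prod E₀)).X.left,
      IsClosed Y ∧ (∀ y ∈ Y, (4 : ℕ∞) ≤ Order.coheight y) ∧
      ((q : ℚ) : ℂ) • cupPowTwo ((d : ℂ) • complexBetti.map e.ι 2 a + complexBetti.map Ψ.hom.hom.hom 2 (complexBetti.map e.ι 2 a)) 4
          + w ∈
        classesSupportedOn ((((E₀.prod E₀).prod (E₀.prod E₀)).prod (E₀.prod E₀)).prod (E₀.prod E₀)).X Y (2 * 4) := by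
  obtain ⟨hdim, hsq, ⟨e₀, a₀, ha₀, ha₀0, hhyp₀⟩, -⟩ := pad4Anchor_hyperbolic_weilClass hE hd hψ Ψ hΨ
  -- the anchor is smooth projective of dimension `2·4 = 7 + 1`
  have hX : IsSmoothProjective (2 * 4) ((((E₀.prod E₀).prod (E₀.prod E₀)).prod (E₀.prod E₀)).prod (E₀.prod E₀)).X := by
    have h : IsSmoothProjective ((((E₀.prod E₀).prod (E₀.prod E₀)).prod (E₀.prod E₀)).prod (E₀.prod E₀)).dim
        ((((E₀.prod E₀).prod (E₀.prod E₀)).prod (E₀.prod E₀)).prod (E₀.prod E₀)).X :=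
      AbelianVariety.isSmoothProjective_holds
    rwa [hdim] at h
  have hdim' : ((((E₀.prod E₀).prod (E₀.prod E₀)).prod (E₀.prod E₀)).prod (E₀.prod E₀)).dim = 7 + 1 := by
    rw [hdim]
  -- `h_K` is rational of type `(1,1)`, hence `h_K⁴` rational of type `(4,4)`
  have hKr := isRationalClass_ksymm d Ψ e ha
  have hK11 : IsOfHodgeType (2 * 4) ((((E₀.prod E₀).prod (E₀.prod E₀)).prod (E₀.prod E₀)).prod (E₀.prod E₀)).X 2 1 1
      ((d : ℂ) • complexBetti.map e.ι 2 a + complexBetti.map Ψ.hom.hom.hom 2 (complexBetti.map e.ι 2 a)) :=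
    isOfHodgeType_one_one_ksymm hdim' hd Ψ e ha ha0
  have hK44 := isOfHodgeType_cupPowTwo hX hK11 4
  -- `(S⁴, Ψ)` is of Weil type (hyperbolic for `h_K(e₀, a₀)`), so `w` is of type `(4,4)`
  have hWT : IsWeilType _ Ψ 4 d := isWeilType_of_isHyperbolicWeilType (by norm_num) hd hdim hsq e₀ ha₀ ha₀0 hhyp₀
  have hw44 := hWT.isOfHodgeType_of_mem_weilClassesOf hwW
  exact pad4_hodgeClass_supportedOn_closed hE (((hKr.cupPowTwo 4).smul q).add hwr) ((hK44.smul _).add hX hw44)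

end Pad4

/-! ## §3 The carrier stub's shape with a CLOSED SUPPORT holds (every `d`, every CM datum) -/

section CarrierShape

variable {d : ℕ} {E₀ : AbelianVariety ℂ} {ψ₀ : E₀ ⟶ E₀}

/-- **`stub_pad4_carrier` with «integral scheme + regular immersion of codimension `4`» replaced by «Zariski-closed subset of
codimension `≥ 4`» HOLDS, every `d ≥ 1`, every CM datum.** There are a projective embedding `e` of `S⁴(E₀)`, a rational `a ≠ 0` with
`(S⁴, Ψ)` HYPERBOLIC in half-dimension `4` for `h_K = d·e^*a + Ψ^*e^*a` (so the same data also serve the rung stub's anchor clauses), a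
non-zero rational class `w` of the Weil plane, and FOR EVERY `q ∈ ℚ` a Zariski-closed `Y ⊂ S⁴` of codimension `≥ 4` supporting
`q·h_K⁴ + w` (the tree's `pad4Anchor_hyperbolic_weilClass` and `pad4_ksymmPow_add_weil_supportedOn_closed`). What the stub asks beyond this: ONE such support
which is (the image of) an INTEGRAL local complete intersection of codimension exactly `4` — by purity (`H⁸_Z = ℂ·cl(Z)`, Fulton
Lemma 19.1.1, not in the tree) that is the condition `cl(Z) ∈ ℚ·h_K⁴ ⊕ W_K` with non-zero Weil part, forcing `q ≠ 0`.
[cite: vanGeemen1994HodgeAV, Thm. 4.3, Lemma 5.2, 5.3–5.4] [cite: Fulton1998, §19.1 Lemma 19.1.1] [cite: Bloch1972Semiregularity, Remark (7.5)] -/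
theorem exists_pad4_carrierShape_closedSupport (hd : 0 < d) (hE : E₀.dim = 1) (hψ : ψ₀ ≫ ψ₀ = -(d • 𝟙 E₀))
    (Ψ : (((E₀.prod E₀).prod (E₀.prod E₀)).prod (E₀.prod E₀)).prod (E₀.prod E₀) ⟶
      (((E₀.prod E₀).prod (E₀.prod E₀)).prod (E₀.prod E₀)).prod (E₀.prod E₀))
    (hΨ : Ψ = AbelianVariety.prodLift
        (AbelianVariety.fst (((E₀.prod E₀).prod (E₀.prod E₀)).prod (E₀.prod E₀)) (E₀.prod E₀) ≫
          AbelianVariety.prodLift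
            (AbelianVariety.fst ((E₀.prod E₀).prod (E₀.prod E₀)) (E₀.prod E₀) ≫
              AbelianVariety.prodLift
                (AbelianVariety.fst (E₀.prod E₀) (E₀.prod E₀) ≫
                  AbelianVariety.prodLift (AbelianVariety.fst E₀ E₀ ≫ ψ₀) (AbelianVariety.snd E₀ E₀ ≫ (-ψ₀)))
                (AbelianVariety.snd (E₀.prod E₀) (E₀.prod E₀) ≫
                  AbelianVariety.prodLift (AbelianVariety.fst E₀ E₀ ≫ ψ₀) (AbelianVariety.snd E₀ E₀ ≫ (-ψ₀))))
            (AbelianVariety.snd ((E₀.prod E₀).prod (E₀.prod E₀)) (E₀.prod E₀) ≫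
              AbelianVariety.prodLift (AbelianVariety.fst E₀ E₀ ≫ ψ₀) (AbelianVariety.snd E₀ E₀ ≫ (-ψ₀))))
        (AbelianVariety.snd (((E₀.prod E₀).prod (E₀.prod E₀)).prod (E₀.prod E₀)) (E₀.prod E₀) ≫
          AbelianVariety.prodLift (AbelianVariety.fst E₀ E₀ ≫ ψ₀) (AbelianVariety.snd E₀ E₀ ≫ (-ψ₀)))) :
    ∃ (e : ProjectiveEmbedding ((((E₀.prod E₀).prod (E₀.prod E₀)).prod (E₀.prod E₀)).prod (E₀.prod E₀)).X)
      (a : complexBetti (projectiveSpace e.n ℂ) 2)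
      (w : complexBetti ((((E₀.prod E₀).prod (E₀.prod E₀)).prod (E₀.prod E₀)).prod (E₀.prod E₀)).X (2 * 4)),
      IsRationalClass a ∧ a ≠ 0 ∧
      IsHyperbolicWeilType _ Ψ 4
        ((d : ℂ) • complexBetti.map e.ι 2 a + complexBetti.map Ψ.hom.hom.hom 2 (complexBetti.map e.ι 2 a)) ∧
      w ∈ weilClassesOf _ Ψ 4 d ∧ IsRationalClass w ∧ w ≠ 0 ∧
      ∀ q : ℚ, ∃ Y : Set ((((E₀.prod E₀).prod (E₀.prod E₀)).prod (E₀.prod E₀)).prod (E₀.prod E₀)).X.left,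
        IsClosed Y ∧ (∀ y ∈ Y, (4 : ℕ∞) ≤ Order.coheight y) ∧
        ((q : ℚ) : ℂ) •
              cupPowTwo ((d : ℂ) • complexBetti.map e.ι 2 a + complexBetti.map Ψ.hom.hom.hom 2 (complexBetti.map e.ι 2 a)) 4 +
            w ∈
          classesSupportedOn ((((E₀.prod E₀).prod (E₀.prod E₀)).prod (E₀.prod E₀)).prod (E₀.prod E₀)).X Y (2 * 4) := by
  obtain ⟨-, -, ⟨e, a, ha, ha0, hhyp⟩, ⟨w, hwr, -, hwW, hw0⟩⟩ := pad4Anchor_hyperbolic_weilClass hE hd hψ Ψ hΨ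
  exact ⟨e, a, w, ha, ha0, hhyp, hwW, hwr, hw0,
    fun q => pad4_ksymmPow_add_weil_supportedOn_closed hd hE hψ Ψ hΨ e ha ha0 q hwW hwr⟩

end CarrierShape

/-! ## §4 The rung's Bloch-semiregularity clause at `(2·4, 4)`, unfolded once (general `X`) -/

section Semiregularity

/-- **Bloch semiregularity of a fourfold in an eightfold, unfolded**: for any `i : Z ⟶ X` over `ℂ`, `IsBlochSemiregular i (2·4) 4`
iff Bloch's pairing map `H³(X, Ω⁵_X) → H³(X, 𝓐lt₃(𝓘; Ω⁸_X|_Z))` (`blochPairingMap i 3 5 3`; by Buchweitz–Flenner (8.1) (2) the Serre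
dual of `π : H¹(Z, 𝒩_{Z/X}) → H⁵(X, Ω³_X)`) is surjective — the tree's `isBlochSemiregular_iff` at `r = 3`, `m = 4`, `k = 3`. This is
the semiregularity clause of `stub_rung_pad4_seedAt` (at `X := S⁴(E₀)`), the only clause of the rung beyond the carrier.
[cite: BuchweitzFlenner2003, (8.1) (2)] [cite: Bloch1972Semiregularity, Remark (7.5)] -/
theorem isBlochSemiregular_eight_four_iff {X : Motives.SchemeOver ℂ} {Z : Scheme.{0}} (i : Z ⟶ X.left) :
    IsBlochSemiregular i (2 * 4) 4 ↔ Function.Surjective (blochPairingMap i 3 (4 + 1) 3) :=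
  isBlochSemiregular_iff (r := 3) (m := 4) (k := 3) rfl rfl rfl

end Semiregularity

end Summit.HodgeConjecture.HodgeConjecture.Theorems

end
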